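import Summits.BirchSwinnertonDyer.BirchSwinnertonDyer.Theorems.PrintCFramBottomClassIndexLawFiveLeHeegnerFieldSupplySocket
import Summits.BirchSwinnertonDyer.BirchSwinnertonDyer.Theorems.PrintCFramBottomClassIndexLawFiveLeHeegnerFamilySplitting
import Literature.NumberTheory.EllipticCurves.HeegnerHypothesisKroneckerProofs
import HarnessLib

/-!
# Crux `PrintCFram.BottomClassIndexLawFiveLe` (stmt-BirchSwinnertonDyer-20372), line `eisenstein-resource-bdp-line` (registry v19):
# STUB C RE-INDEXED BY THE HEEGNER FAMILY — `(P_fam) ⟺ (P)` and `(P_fam) ⟹ C`: Stub C holds as soon as, for each `(p, m, χ, k)`, ONE pair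
# `(n, t)` with `pm ∣ n`, `gcd(t, 2pm) = 1`, `t² < 4n`, `disc(t² − 4n) ≠ −3` has unit field factor `‖B_{k,(χ·ε_{disc(t²−4n)})~}/k‖_p = 1`
# (cell `bsd-print-cfram`, width seat `bsd-line-cfram-p1-w8` g4; THEOREMS ONLY, `--supports` 20372; BSD is not proved by any of this)

HONEST FRAMING. A reduction, not a proof of Stub C. `(P)` is the curve-free supply statement of `…HeegnerFieldSupplySocket`
(`stubC_of_splitPrimes_bernoulliUnit`: `(P) ⟹ C`). `(P_fam)` has the same binders and replaces the four requirements on the field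
(«imaginary», «`d_K` odd», «`d_K < −4`», «every prime of `p·m` splits») by the arithmetic of the CM family `d_K·F² = t² − 4n`
(`…HeegnerFamilySplitting`): `t² < 4n`, `pm ∣ n`, `t` coprime to `2pm`, `d_K ≠ −3`. §2 proves `(P_fam) ⟹ (P)`; §3 proves the converse
`(P) ⟹ (P_fam)` (every admissible field occurs in the family with `F = 1`: the Heegner condition `4pm ∣ β² − d_K`,
`Quadratic.exists_dvd_sq_sub_discr_of_ncard_primesOver`, gives `t = β`, `n = (β² − d_K)/4`), so NOTHING is lost: `(P_fam) ⟺ (P)` (§3);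
§4: `(P_fam) ⟹ C` verbatim. What is left in `(P_fam)` is one `p`-adic unit condition on a generalized Bernoulli number indexed by `(n, t)`
with `n` in the ideal `(pm)` — the index set of the Eichler–Selberg / Cohen class-number relations (`Σ_{s² ≤ 4n} H(k, 4n − s²)` is the
`n`-th coefficient of a modular form of weight `k + 1`, Cohen 1975), where a Horie-type (trace formula) or Eisenstein-type non-vanishing
argument would operate; the condition AT `p` (split), which no printed supply theorem controls, is free here (`p ∣ n`). Data (this seat's
crux notes `Lines/eisenstein-resource-bdp-line-w8g4-notes.md`, exact rationals): for `p ∈ {7, 11, 19}` and ten class characters the first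
index `n = 2pm` already carries admissible `t` with unit field factor in all 52 rows (586/668 admissible `t`). Nothing here proves `(P_fam)`.
beyond-print theorem: NO. References: [Cox2013] §7.A, Prop. 5.16; [Gross1984] §3 (Heegner condition); [KrizLi2019] Thm. 1.20, §8;
Cohen, Math. Ann. 217 (1975); Horie, Math. Ann. 288 (1990).
-/

set_option autoImplicit false
-- summit-side namespace `Summit.BirchSwinnertonDyer.BirchSwinnertonDyer.…` (single-conjunct summit, D-0017 layout)
set_option linter.dupNamespace false

noncomputable section

open scoped Classical
open NumberField WeierstrassCurve DirichletCharacter Literature.NumberTheory.LFunctions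
  Literature.NumberTheory.EllipticCurves Literature.NumberTheory.EllipticCurves.KrizLi2019
  Literature.NumberTheory.EllipticCurves.Rank1Residual
open Literature.NumberTheory.Congruences Literature.NumberTheory.QuadraticFields

namespace Summit.BirchSwinnertonDyer.BirchSwinnertonDyer.Theorems.PrintCFram.HeegnerFieldSupply

open Summit.BirchSwinnertonDyer.BirchSwinnertonDyer.Theorems.PrintCFram
open Summit.BirchSwinnertonDyer.BirchSwinnertonDyer.Theorems.PrintCFram.HeegnerFamily
open Summit.BirchSwinnertonDyer.Rank1Residual.X12.O11

/-! ## §1 Two coprimality lemmas -/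

/-- `t` coprime to `2·M` is odd. [folklore] -/
theorem odd_of_isCoprime_two_mul {t M : ℤ} (h : IsCoprime t (2 * M)) : Odd t := by
  refine Int.not_even_iff_odd.mp fun ⟨r, hr⟩ ↦ ?_
  have hu : IsUnit (2 : ℤ) := h.isUnit_of_dvd' ⟨r, by omega⟩ (dvd_mul_right 2 M)
  have h1 := Int.isUnit_iff.mp hu
  omega

/-- A prime dividing `M` does not divide an integer coprime to `M`. [folklore] -/
theorem not_dvd_of_isCoprime {t : ℤ} {M q : ℕ} (h : IsCoprime t (M : ℤ)) (hq : q.Prime) (hqM : q ∣ M) : ¬ (q : ℤ) ∣ t := by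
  intro hqt
  have hu : IsUnit (q : ℤ) := h.isUnit_of_dvd' hqt (Int.natCast_dvd_natCast.mpr hqM)
  have h1 := Int.isUnit_iff.mp hu
  have h2 := hq.two_le
  omega

/-! ## §2 `(P_fam) ⟹ (P)` -/

/-- **THE HEEGNER-FAMILY FORM IMPLIES THE SPLIT-PRIMES FORM: `(P_fam) ⟹ (P)`.** In `(P_fam)` the supplier exhibits, for each `(p, m, χ, k)`
as in `(P)`, integers `n, t, F`, a quadratic field `K` with `d_K·F² = t² − 4n`, `t² < 4n`, `pm ∣ n`, `t` coprime to `2pm`, `d_K ≠ −3`, a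
Kronecker character `ε_K` and a UNIT field factor; then `K` is imaginary (`t² < 4n`), `d_K` is odd (`t` odd) and `< −4` (`d_K ≠ −3`), and
every prime `q` of `p·m` splits in `K` (`q ∣ n`, `q ∤ t`) — the four side conditions of `(P)`. [cite: Cox2013, §7.A (7.2)–(7.3) and Prop. 5.16] -/
theorem splitPrimes_bernoulliUnit_of_heegnerFamily
    (hF : ∀ (p : ℕ) [Fact p.Prime] (m : ℕ) [NeZero m] (χ : DirichletCharacter ℚ_[p] m) (k : ℕ),
      5 ≤ p → m.Coprime p → χ.IsPrimitive → χ.IsQuadratic → (k = (p + 1) / 4 ∨ k = (3 * p - 1) / 4) →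
      2 ≤ k → k ≤ p - 2 → χ (-1) * (-1) ^ k = -1 →
      ¬ ‖((p - k : ℕ) : ℚ_[p])⁻¹ * generalizedBernoulli (p - k) χ‖ ≤ (p : ℝ)⁻¹ →
      ∃ (n t F : ℤ) (K : Type) (_ : Field K) (_ : NumberField K)
        (εK : DirichletCharacter ℚ_[p] (NumberField.discr K).natAbs),
        Module.finrank ℚ K = 2 ∧ NumberField.discr K * F ^ 2 = t ^ 2 - 4 * n ∧ t ^ 2 < 4 * n ∧
        ((p * m : ℕ) : ℤ) ∣ n ∧ IsCoprime t ((2 * p * m : ℕ) : ℤ) ∧ NumberField.discr K ≠ -3 ∧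
        IsKroneckerCharacterOf K εK ∧
        ¬ ‖(k : ℚ_[p])⁻¹ * @generalizedBernoulli ℚ_[p] _ _
            (changeLevel (dvd_mul_right m (NumberField.discr K).natAbs) χ *
              changeLevel (dvd_mul_left (NumberField.discr K).natAbs m) εK).conductor ⟨conductor_ne_zero _⟩ k
            (changeLevel (dvd_mul_right m (NumberField.discr K).natAbs) χ *
              changeLevel (dvd_mul_left (NumberField.discr K).natAbs m) εK).primitiveCharacter‖ ≤ (p : ℝ)⁻¹) :
    ∀ (p : ℕ) [Fact p.Prime] (m : ℕ) [NeZero m] (χ : DirichletCharacter ℚ_[p] m) (k : ℕ),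
      5 ≤ p → m.Coprime p → χ.IsPrimitive → χ.IsQuadratic → (k = (p + 1) / 4 ∨ k = (3 * p - 1) / 4) →
      2 ≤ k → k ≤ p - 2 → χ (-1) * (-1) ^ k = -1 →
      ¬ ‖((p - k : ℕ) : ℚ_[p])⁻¹ * generalizedBernoulli (p - k) χ‖ ≤ (p : ℝ)⁻¹ →
      ∃ (K : Type) (_ : Field K) (_ : NumberField K) (εK : DirichletCharacter ℚ_[p] (NumberField.discr K).natAbs),
        IsImaginaryQuadratic K ∧
        (∀ q : ℕ, q.Prime → q ∣ p * m → ((Ideal.span {(q : ℤ)}).primesOver (𝓞 K)).ncard = 2) ∧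
        Odd (NumberField.discr K) ∧ NumberField.discr K < -4 ∧ IsKroneckerCharacterOf K εK ∧
        ¬ ‖(k : ℚ_[p])⁻¹ * @generalizedBernoulli ℚ_[p] _ _
            (changeLevel (dvd_mul_right m (NumberField.discr K).natAbs) χ *
              changeLevel (dvd_mul_left (NumberField.discr K).natAbs m) εK).conductor ⟨conductor_ne_zero _⟩ k
            (changeLevel (dvd_mul_right m (NumberField.discr K).natAbs) χ *
              changeLevel (dvd_mul_left (NumberField.discr K).natAbs m) εK).primitiveCharacter‖ ≤ (p : ℝ)⁻¹ := by
  intro p _ m _ χ k h5 hmp hχ hχq hk hk2 hkp hpar hcls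
  obtain ⟨n, t, F, K, iK, iK', εK, h2, h, hlt, hMn, hMt, h3, hεK, hfld⟩ := hF p m χ k h5 hmp hχ hχq hk hk2 hkp hpar hcls
  have ht : Odd t := odd_of_isCoprime_two_mul (M := ((p * m : ℕ) : ℤ)) (by push_cast at hMt ⊢; simpa [mul_assoc] using hMt)
  refine ⟨K, iK, iK', εK, isImaginaryQuadratic_of_discr_mul_sq_eq h2 h hlt, fun q hq hqpm ↦ ?_, odd_of_mul_sq_eq h ht,
    discr_lt_neg_four_of_discr_mul_sq_eq h2 h ht hlt h3, hεK, hfld⟩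
  have hq2pm : q ∣ 2 * p * m := by rw [mul_assoc]; exact dvd_mul_of_dvd_right hqpm 2
  exact ncard_primesOver_eq_two_of_dvd_of_not_dvd h2 h hq ((Int.natCast_dvd_natCast.mpr hqpm).trans hMn)
    (not_dvd_of_isCoprime hMt hq hq2pm)

/-! ## §3 `(P) ⟹ (P_fam)`: every admissible field lies in the family (with `F = 1`); `(P_fam) ⟺ (P)` -/

/-- **THE CONVERSE `(P) ⟹ (P_fam)`: nothing is lost by the re-indexing.** Given `K` imaginary quadratic with `d_K` odd `< −4` in which
every prime of `p·m` splits, the Heegner condition (`Quadratic.exists_dvd_sq_sub_discr_of_ncard_primesOver`, Gross 1984 §3) gives `β` with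
`4pm ∣ β² − d_K`; then `t := β`, `n := (β² − d_K)/4`, `F := 1` lie in the family: `pm ∣ n`, `t² < 4n` (`d_K < 0`), `t` odd (`d_K` odd) and prime
to every `q ∣ pm` (`q ∣ t` would force `q ∣ d_K`, but split primes are unramified: `SatisfiesHeegnerHypothesis.not_dvd_discr`).
[cite: Gross1984, §3 (the Heegner condition `D ≡ β² (mod 4N)`)] [cite: Cox2013, §7.A (7.2)–(7.3)] -/
theorem heegnerFamily_of_splitPrimes_bernoulliUnit
    (hP : ∀ (p : ℕ) [Fact p.Prime] (m : ℕ) [NeZero m] (χ : DirichletCharacter ℚ_[p] m) (k : ℕ),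
      5 ≤ p → m.Coprime p → χ.IsPrimitive → χ.IsQuadratic → (k = (p + 1) / 4 ∨ k = (3 * p - 1) / 4) →
      2 ≤ k → k ≤ p - 2 → χ (-1) * (-1) ^ k = -1 →
      ¬ ‖((p - k : ℕ) : ℚ_[p])⁻¹ * generalizedBernoulli (p - k) χ‖ ≤ (p : ℝ)⁻¹ →
      ∃ (K : Type) (_ : Field K) (_ : NumberField K) (εK : DirichletCharacter ℚ_[p] (NumberField.discr K).natAbs),
        IsImaginaryQuadratic K ∧
        (∀ q : ℕ, q.Prime → q ∣ p * m → ((Ideal.span {(q : ℤ)}).primesOver (𝓞 K)).ncard = 2) ∧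
        Odd (NumberField.discr K) ∧ NumberField.discr K < -4 ∧ IsKroneckerCharacterOf K εK ∧
        ¬ ‖(k : ℚ_[p])⁻¹ * @generalizedBernoulli ℚ_[p] _ _
            (changeLevel (dvd_mul_right m (NumberField.discr K).natAbs) χ *
              changeLevel (dvd_mul_left (NumberField.discr K).natAbs m) εK).conductor ⟨conductor_ne_zero _⟩ k
            (changeLevel (dvd_mul_right m (NumberField.discr K).natAbs) χ *
              changeLevel (dvd_mul_left (NumberField.discr K).natAbs m) εK).primitiveCharacter‖ ≤ (p : ℝ)⁻¹) :
    ∀ (p : ℕ) [Fact p.Prime] (m : ℕ) [NeZero m] (χ : DirichletCharacter ℚ_[p] m) (k : ℕ),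
      5 ≤ p → m.Coprime p → χ.IsPrimitive → χ.IsQuadratic → (k = (p + 1) / 4 ∨ k = (3 * p - 1) / 4) →
      2 ≤ k → k ≤ p - 2 → χ (-1) * (-1) ^ k = -1 →
      ¬ ‖((p - k : ℕ) : ℚ_[p])⁻¹ * generalizedBernoulli (p - k) χ‖ ≤ (p : ℝ)⁻¹ →
      ∃ (n t F : ℤ) (K : Type) (_ : Field K) (_ : NumberField K)
        (εK : DirichletCharacter ℚ_[p] (NumberField.discr K).natAbs),
        Module.finrank ℚ K = 2 ∧ NumberField.discr K * F ^ 2 = t ^ 2 - 4 * n ∧ t ^ 2 < 4 * n ∧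
        ((p * m : ℕ) : ℤ) ∣ n ∧ IsCoprime t ((2 * p * m : ℕ) : ℤ) ∧ NumberField.discr K ≠ -3 ∧
        IsKroneckerCharacterOf K εK ∧
        ¬ ‖(k : ℚ_[p])⁻¹ * @generalizedBernoulli ℚ_[p] _ _
            (changeLevel (dvd_mul_right m (NumberField.discr K).natAbs) χ *
              changeLevel (dvd_mul_left (NumberField.discr K).natAbs m) εK).conductor ⟨conductor_ne_zero _⟩ k
            (changeLevel (dvd_mul_right m (NumberField.discr K).natAbs) χ *
              changeLevel (dvd_mul_left (NumberField.discr K).natAbs m) εK).primitiveCharacter‖ ≤ (p : ℝ)⁻¹ := by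
  intro p _ m _ χ k h5 hmp hχ hχq hk hk2 hkp hpar hcls
  obtain ⟨K, iK, iK', εK, hK, hsplit, hodd, hd4, hεK, hfld⟩ := hP p m χ k h5 hmp hχ hχq hk hk2 hkp hpar hcls
  have hpp : p.Prime := Fact.out
  have h2 : Module.finrank ℚ K = 2 := hK.1
  have hpm0 : p * m ≠ 0 := Nat.mul_ne_zero hpp.ne_zero (NeZero.ne m)
  obtain ⟨β, c, hc⟩ := Quadratic.exists_dvd_sq_sub_discr_of_ncard_primesOver h2 hpm0 hsplit
  -- `β` is odd: `β² = d_K + 4·pm·c` with `d_K` odd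
  have hβ : _root_.Odd β := by
    have hsq : _root_.Odd (β ^ 2) := by
      rw [show β ^ 2 = NumberField.discr K + 2 * (2 * ((p * m : ℕ) : ℤ) * c) by linear_combination hc]
      exact hodd.add_even (even_two_mul _)
    rw [sq] at hsq
    exact Int.Odd.of_mul_left hsq
  -- `β` is prime to every `q ∣ pm`: such `q` splits, hence `q ∤ d_K`
  have hH : SatisfiesHeegnerHypothesis (p * m) K := hsplit
  have hcop : IsCoprime β ((2 * p * m : ℕ) : ℤ) := by
    rw [Int.isCoprime_iff_gcd_eq_one]
    show β.natAbs.gcd ((2 * p * m : ℕ) : ℤ).natAbs = 1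
    rw [Int.natAbs_natCast]
    refine Nat.Coprime.gcd_eq_one (Nat.coprime_of_dvd fun q hq hqβ hqM ↦ ?_)
    have hqβ' : (q : ℤ) ∣ β := Int.natCast_dvd.mpr hqβ
    by_cases hq2 : q = 2
    · subst hq2
      exact Int.not_even_iff_odd.mpr hβ (even_iff_two_dvd.mpr hqβ')
    · have hqpm : q ∣ p * m := by
        rw [mul_assoc] at hqM
        rcases (Nat.Prime.dvd_mul hq).mp hqM with h2' | h'
        · exact absurd ((Nat.prime_dvd_prime_iff_eq hq Nat.prime_two).mp h2') hq2
        · exact h'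
      refine Literature.SatisfiesHeegnerHypothesis.not_dvd_discr h2 hH hq hqpm ?_
      rw [show NumberField.discr K = β ^ 2 - 4 * ((p * m : ℕ) : ℤ) * c by linear_combination -hc]
      exact (dvd_pow hqβ' two_ne_zero).sub
        (((Int.natCast_dvd_natCast.mpr hqpm).mul_left 4).mul_right c)
  refine ⟨((p * m : ℕ) : ℤ) * c, β, 1, K, iK, iK', εK, h2, by linear_combination -hc, by linarith, dvd_mul_right _ _, hcop,
    by omega, hεK, hfld⟩

/-- **`(P_fam) ⟺ (P)`**: the Heegner-family form and the split-primes form of the supply statement for Stub C are equivalent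
(§2 and the converse above). [cite: Cox2013, §7.A (7.2)–(7.3) and Prop. 5.16] [cite: Gross1984, §3] -/
theorem heegnerFamily_iff_splitPrimes_bernoulliUnit :
    (∀ (p : ℕ) [Fact p.Prime] (m : ℕ) [NeZero m] (χ : DirichletCharacter ℚ_[p] m) (k : ℕ),
      5 ≤ p → m.Coprime p → χ.IsPrimitive → χ.IsQuadratic → (k = (p + 1) / 4 ∨ k = (3 * p - 1) / 4) →
      2 ≤ k → k ≤ p - 2 → χ (-1) * (-1) ^ k = -1 →
      ¬ ‖((p - k : ℕ) : ℚ_[p])⁻¹ * generalizedBernoulli (p - k) χ‖ ≤ (p : ℝ)⁻¹ →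
      ∃ (n t F : ℤ) (K : Type) (_ : Field K) (_ : NumberField K)
        (εK : DirichletCharacter ℚ_[p] (NumberField.discr K).natAbs),
        Module.finrank ℚ K = 2 ∧ NumberField.discr K * F ^ 2 = t ^ 2 - 4 * n ∧ t ^ 2 < 4 * n ∧
        ((p * m : ℕ) : ℤ) ∣ n ∧ IsCoprime t ((2 * p * m : ℕ) : ℤ) ∧ NumberField.discr K ≠ -3 ∧
        IsKroneckerCharacterOf K εK ∧
        ¬ ‖(k : ℚ_[p])⁻¹ * @generalizedBernoulli ℚ_[p] _ _
            (changeLevel (dvd_mul_right m (NumberField.discr K).natAbs) χ *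
              changeLevel (dvd_mul_left (NumberField.discr K).natAbs m) εK).conductor ⟨conductor_ne_zero _⟩ k
            (changeLevel (dvd_mul_right m (NumberField.discr K).natAbs) χ *
              changeLevel (dvd_mul_left (NumberField.discr K).natAbs m) εK).primitiveCharacter‖ ≤ (p : ℝ)⁻¹) ↔
    (∀ (p : ℕ) [Fact p.Prime] (m : ℕ) [NeZero m] (χ : DirichletCharacter ℚ_[p] m) (k : ℕ),
      5 ≤ p → m.Coprime p → χ.IsPrimitive → χ.IsQuadratic → (k = (p + 1) / 4 ∨ k = (3 * p - 1) / 4) →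
      2 ≤ k → k ≤ p - 2 → χ (-1) * (-1) ^ k = -1 →
      ¬ ‖((p - k : ℕ) : ℚ_[p])⁻¹ * generalizedBernoulli (p - k) χ‖ ≤ (p : ℝ)⁻¹ →
      ∃ (K : Type) (_ : Field K) (_ : NumberField K) (εK : DirichletCharacter ℚ_[p] (NumberField.discr K).natAbs),
        IsImaginaryQuadratic K ∧
        (∀ q : ℕ, q.Prime → q ∣ p * m → ((Ideal.span {(q : ℤ)}).primesOver (𝓞 K)).ncard = 2) ∧
        Odd (NumberField.discr K) ∧ NumberField.discr K < -4 ∧ IsKroneckerCharacterOf K εK ∧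
        ¬ ‖(k : ℚ_[p])⁻¹ * @generalizedBernoulli ℚ_[p] _ _
            (changeLevel (dvd_mul_right m (NumberField.discr K).natAbs) χ *
              changeLevel (dvd_mul_left (NumberField.discr K).natAbs m) εK).conductor ⟨conductor_ne_zero _⟩ k
            (changeLevel (dvd_mul_right m (NumberField.discr K).natAbs) χ *
              changeLevel (dvd_mul_left (NumberField.discr K).natAbs m) εK).primitiveCharacter‖ ≤ (p : ℝ)⁻¹) :=
  ⟨splitPrimes_bernoulliUnit_of_heegnerFamily, heegnerFamily_of_splitPrimes_bernoulliUnit⟩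

/-! ## §4 Stub C from `(P_fam)` -/

/-- **Stub C VERBATIM ⟸ `(P_fam)`** (registry v19 `stub_heegnerField_of_unitClassFactor`): §2 composed with `stubC_of_splitPrimes_bernoulliUnit`.
So the whole of Stub C is: for each class character `χ_e` mod `m` and `p`, ONE index `n ∈ pm·ℤ` and ONE `t` prime to `2pm` with
`t² < 4n`, `disc(t² − 4n) ≠ −3`, and `p ∤ B_{k,(χ_e·ε_{disc(t²−4n)})~}/k`. [cite: KrizLi2019, Thm. 1.20 (p. 8) and §8 (pp. 49–52)]
[cite: Cox2013, §7.A (7.2)–(7.3) and Prop. 5.16] -/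
theorem stubC_of_heegnerFamily_bernoulliUnit
    (hF : ∀ (p : ℕ) [Fact p.Prime] (m : ℕ) [NeZero m] (χ : DirichletCharacter ℚ_[p] m) (k : ℕ),
      5 ≤ p → m.Coprime p → χ.IsPrimitive → χ.IsQuadratic → (k = (p + 1) / 4 ∨ k = (3 * p - 1) / 4) →
      2 ≤ k → k ≤ p - 2 → χ (-1) * (-1) ^ k = -1 →
      ¬ ‖((p - k : ℕ) : ℚ_[p])⁻¹ * generalizedBernoulli (p - k) χ‖ ≤ (p : ℝ)⁻¹ →
      ∃ (n t F : ℤ) (K : Type) (_ : Field K) (_ : NumberField K)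
        (εK : DirichletCharacter ℚ_[p] (NumberField.discr K).natAbs),
        Module.finrank ℚ K = 2 ∧ NumberField.discr K * F ^ 2 = t ^ 2 - 4 * n ∧ t ^ 2 < 4 * n ∧
        ((p * m : ℕ) : ℤ) ∣ n ∧ IsCoprime t ((2 * p * m : ℕ) : ℤ) ∧ NumberField.discr K ≠ -3 ∧
        IsKroneckerCharacterOf K εK ∧
        ¬ ‖(k : ℚ_[p])⁻¹ * @generalizedBernoulli ℚ_[p] _ _
            (changeLevel (dvd_mul_right m (NumberField.discr K).natAbs) χ *
              changeLevel (dvd_mul_left (NumberField.discr K).natAbs m) εK).conductor ⟨conductor_ne_zero _⟩ k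
            (changeLevel (dvd_mul_right m (NumberField.discr K).natAbs) χ *
              changeLevel (dvd_mul_left (NumberField.discr K).natAbs m) εK).primitiveCharacter‖ ≤ (p : ℝ)⁻¹) :
    ∀ (W : WeierstrassCurve ℚ) [W.IsElliptic] [W.IsGloballyMinimal] (p : ℕ) [Fact p.Prime], W.HasCM → CMRamified W p → 5 ≤ p →
      W.analyticRank = 1 → ∀ (f : ℕ) [NeZero f] (ψ : DirichletCharacter ℚ_[p] f) (ω : DirichletCharacter ℚ_[p] p), ψ.Odd →
      IsTeichmullerCharacter ω →
      (∀ ℓ : ℕ, ℓ.Prime → ¬ (ℓ ∣ p * W.conductorNorm ℤ) →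
        ‖((W.LFunction ℓ : ℤ) : ℚ_[p]) - (ψ (ℓ : ZMod f) + ψ⁻¹ (ℓ : ZMod f) * ω (ℓ : ZMod p))‖ < 1) →
      ¬ ‖bernoulliOnePrim ψ⁻¹‖ ≤ (p : ℝ)⁻¹ →
      ∃ (K : Type) (_ : Field K) (_ : NumberField K) (εK : DirichletCharacter ℚ_[p] (NumberField.discr K).natAbs),
        IsImaginaryQuadratic K ∧ SatisfiesHeegnerHypothesis (W.conductorNorm ℤ) K ∧ Odd (NumberField.discr K) ∧
        NumberField.discr K < -4 ∧ IsKroneckerCharacterOf K εK ∧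
        ¬ ‖bernoulliOnePrim (bernoulliCharTwo ψ εK ω)‖ ≤ (p : ℝ)⁻¹ :=
  stubC_of_splitPrimes_bernoulliUnit (splitPrimes_bernoulliUnit_of_heegnerFamily hF)

end Summit.BirchSwinnertonDyer.BirchSwinnertonDyer.Theorems.PrintCFram.HeegnerFieldSupply

end
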